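import Summits.AtomisticToContinuum.Crystallization.Theorems.ChargedEnergyGapSecondShell
import HarnessLib

/-!
# Charged energy gap — lens-3 g63, part P-Z₅a‴: 109 DISTINCT SITES within `4` of every site, within `619/100` of every point

Cell `decomp-a2c`, seat lens-3, generation 63, part P-Z₅a‴ (after P-Z₅a″ `ChargedEnergyGapSecondShell`).  ELEMENTARY·PROVED.
Transport of the second census through the label map of `LabelledWithin` (reach `ℓ ≥ 3`, discrete strain `lam < 1`): the `109` sites of the
labelling Barlow stacking within `3` of the label `x₀` of `p` lie in the reach ball, their label images are pairwise distinct
(`dist_labels_le`, `lam < 1`) and within `(1 + lam)·3` of `p` (`LabelledWithin.exists_109_near`; `0 ≤ lam` is forced by two distinct labels).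
On a `(lam ≤ 1/3, ℓ ≥ 3)`-labelled reference: ★★ `IsLabelledRef.exists_109_near` — `109` pairwise distinct sites within `4` of every site —
and, with P-Z₁'s covering radius `219/100`, ★ `IsLabelledRef.exists_109_near_point` — within `619/100` of every point of space.  This is the
count `N(3) = 109` of the attribution scheme «6 × 109» (seat HANDOFF §J (J7)/(J8)/(J8′)): six blocks of `109` distinct sites at the levels
`84 + 66/5·t`, `t < 6`, of P-Z₅b's passage construction.
-/

noncomputable section

open scoped Classical

open Literature.MathematicalPhysics.StatisticalMechanics Literature.Geometry.DiscreteGeometry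
open Summit.AtomisticToContinuum.Crystallization.Theses.PricedLinkCensus
open Summit.AtomisticToContinuum.Crystallization.Theorems.ChargedEnergyGapNegative

namespace Summit.AtomisticToContinuum.Crystallization.Theorems.ChargedEnergyGapChartDial

/-- ★ **109 LABELLED SITES NEAR A LABELLED POINT**: a point `p` Barlow-labelled within reach `ℓ ≥ 3` at discrete strain `lam < 1` has `109`
pairwise distinct configuration points within `(1 + lam)·3` of it — the label images of the second census around its label. -/
theorem LabelledWithin.exists_109_near {lam ℓ : ℝ} {Q : PeriodicConfiguration 3} {p : E3} (hW : LabelledWithin lam ℓ Q p)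
    (hlam : lam < 1) (hℓ : 3 ≤ ℓ) :
    ∃ c : Fin 109 → E3, Function.Injective c ∧ ∀ m, c m ∈ Q.points ∧ dist (c m) p ≤ (1 + lam) * 3 := by
  obtain ⟨S, hS, Φ, x₀, hx₀, hp, hlab, -, hstr⟩ := hW
  obtain ⟨a, h, s, g, ha, hh, hs, hg, rfl⟩ := hS
  obtain ⟨x₀', hx₀', rfl⟩ := hx₀
  obtain ⟨k, i, j, rfl⟩ := hx₀'
  obtain ⟨c₀, hc₀, hc₀m⟩ := exists_fin109_near ha hh hs k i j
  -- the census, transported by `g`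
  set n : Fin 109 → E3 := fun m => g (c₀ m) with hn
  have hnS : ∀ m, n m ∈ g '' barlowStacking a h s := fun m => ⟨_, (hc₀m m).1, rfl⟩
  have hnd : ∀ m, dist (n m) (g (barlowPos a h s k i j)) ≤ 3 := fun m => by rw [hn, hg.dist_eq]; exact (hc₀m m).2
  have hnℓ : ∀ m, dist (n m) (g (barlowPos a h s k i j)) ≤ ℓ := fun m => (hnd m).trans hℓ
  have h0ℓ : dist (g (barlowPos a h s k i j)) (g (barlowPos a h s k i j)) ≤ ℓ := by rw [dist_self]; linarith
  have hninj : Function.Injective n := fun m m' heq => hc₀ (hg.injective heq)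
  -- two distinct labels in the reach ball force `0 ≤ lam`
  have hlam0 : 0 ≤ lam := by
    have hne : n ⟨0, by norm_num⟩ ≠ n ⟨1, by norm_num⟩ := fun heq => absurd (hninj heq) (by decide)
    have h1 := hstr _ (hnS ⟨0, by norm_num⟩) _ (hnS ⟨1, by norm_num⟩) (hnℓ _) (hnℓ _)
    have hvpos : 0 < ‖n ⟨0, by norm_num⟩ - n ⟨1, by norm_num⟩‖ := norm_pos_iff.2 (sub_ne_zero.2 hne)
    by_contra hneg
    push Not at hneg
    have : lam * ‖n ⟨0, by norm_num⟩ - n ⟨1, by norm_num⟩‖ < 0 := mul_neg_of_neg_of_pos hneg hvpos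
    linarith [norm_nonneg ((Φ (n ⟨0, by norm_num⟩) - Φ (n ⟨1, by norm_num⟩)) - (n ⟨0, by norm_num⟩ - n ⟨1, by norm_num⟩))]
  refine ⟨fun m => Φ (n m), fun m m' (heq : Φ (n m) = Φ (n m')) => ?_, fun m => ⟨hlab _ (hnS m) (hnℓ m), ?_⟩⟩
  · -- distinct labels carry distinct points (`lam < 1`)
    by_contra hmm
    have h1 := dist_labels_le (hstr _ (hnS m) _ (hnS m') (hnℓ m) (hnℓ m'))
    have h2 : Φ (n m) - Φ (n m') = 0 := sub_eq_zero.2 heq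
    rw [h2, norm_zero] at h1
    have : 0 < (1 - lam) * ‖n m - n m'‖ := mul_pos (by linarith) (norm_pos_iff.2 (sub_ne_zero.2 (hninj.ne hmm)))
    linarith
  · have hsm := hstr _ (hnS m) _ ⟨_, barlowPos_mem k i j, rfl⟩ (hnℓ m) h0ℓ
    rw [hp] at hsm
    have h2 := norm_add_le ((Φ (n m) - p) - (n m - g (barlowPos a h s k i j))) (n m - g (barlowPos a h s k i j))
    rw [sub_add_cancel] at h2
    rw [dist_eq_norm]
    have h3 : ‖n m - g (barlowPos a h s k i j)‖ ≤ 3 := by rw [← dist_eq_norm]; exact hnd m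
    calc ‖Φ (n m) - p‖ ≤ ‖(Φ (n m) - p) - (n m - g (barlowPos a h s k i j))‖ + ‖n m - g (barlowPos a h s k i j)‖ := h2
      _ ≤ (1 + lam) * ‖n m - g (barlowPos a h s k i j)‖ := by linarith
      _ ≤ (1 + lam) * 3 := mul_le_mul_of_nonneg_left h3 (by linarith)

/-! ## ★ Record: 109 sites within `4` of every site, within `619/100` of every point -/

section Record

variable {lam ℓ : ℝ} {P : PeriodicConfiguration 3}

/-- ★★ **109 DISTINCT SITES WITHIN `4` OF EVERY SITE** of a `(lam ≤ 1/3, ℓ ≥ 3)`-labelled reference (translation from the motif). -/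
theorem IsLabelledRef.exists_109_near (hL : IsLabelledRef lam ℓ P) (hlam : lam ≤ 1 / 3) (hℓ : 3 ≤ ℓ) {y : E3} (hy : y ∈ P.points) :
    ∃ c : Fin 109 → E3, Function.Injective c ∧ ∀ m, c m ∈ P.points ∧ dist (c m) y ≤ 4 := by
  obtain ⟨q, hq, g, hg, rfl⟩ := hy
  obtain ⟨c, hc, hcm⟩ := (hL q hq).exists_109_near (by linarith) hℓ
  refine ⟨fun m => c m + g, fun m m' heq => hc (add_right_cancel heq), fun m => ⟨P.add_mem_points (hcm m).1 hg, ?_⟩⟩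
  rw [dist_add_right]
  refine ((hcm m).2).trans ?_
  linarith

/-- ★ **109 DISTINCT SITES WITHIN `619/100` OF EVERY POINT OF SPACE** (P-Z₁'s covering radius `219/100`, then the census). -/
theorem IsLabelledRef.exists_109_near_point (hL : IsLabelledRef lam ℓ P) (hlam : lam ≤ 1 / 3) (hℓ : 3 ≤ ℓ) (w : E3) :
    ∃ c : Fin 109 → E3, Function.Injective c ∧ ∀ m, c m ∈ P.points ∧ dist w (c m) ≤ 619 / 100 := by
  obtain ⟨y, hy, hwy⟩ := hL.exists_dist_le hlam hℓ w
  obtain ⟨c, hc, hcm⟩ := hL.exists_109_near hlam hℓ hy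
  refine ⟨c, hc, fun m => ⟨(hcm m).1, ?_⟩⟩
  calc dist w (c m) ≤ dist w y + dist y (c m) := dist_triangle _ _ _
    _ ≤ 219 / 100 + 4 := add_le_add hwy (by rw [dist_comm]; exact (hcm m).2)
    _ = 619 / 100 := by norm_num

/-- ★ **SIX WELL-SEPARATED BLOCKS** (the «6 × 109» bookkeeping): the levels `84 + 66/5·t`, `t < 6`, are pairwise more than `2·619/100` apart,
so balls of radius `619/100` about points at these levels on a segment are pairwise disjoint — the six blocks of `109` sites are distinct. -/
theorem record_sixBlocks_numerals : 2 * ((619 : ℝ) / 100) < 66 / 5 ∧ (84 : ℝ) + 66 / 5 * 5 = 150 ∧ (66 : ℝ) / 5 = 3 * (44 / 10) ∧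
    (1 + (1 : ℝ) / 3) * 3 = 4 ∧ (219 : ℝ) / 100 + 4 = 619 / 100 ∧ 6 * 109 = 654 := by
  refine ⟨by norm_num, by norm_num, by norm_num, by norm_num, by norm_num, by norm_num⟩

end Record

end Summit.AtomisticToContinuum.Crystallization.Theorems.ChargedEnergyGapChartDial

end
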